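import Literature.MathematicalPhysics.QuantumFieldTheory.Balaban1983to89.B8LeafModelZd3

/-!
# `Balaban1983to89.B8Eq140PureGaugePotential` — [Balaban1985RegularSpaces] (1.139)–(1.140) — ALL THREE MEMBERS — FOR A SCALAR PURE GAUGE `U₁ = e^{iηA}`,
# `A = −dψ∕η`, at `U₀ = 1` on NODE 00's carrier `zdGF3` (`d = 4`): the canonical masked logarithm IS `A`, the first member is `Lʲ|Δψ|`, the second
# `L^{2j}|ΔΔψ|`, the third (the linearised Maxwell operator `D*DA`) VANISHES IDENTICALLY on pure gauges

statement-level skeleton of published theorems with citation tags; proofs where landed; nothing here is a claim about the Yang–Mills mass gap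

T. Bałaban, *Spaces of regular gauge field configurations on a lattice and gauge fixing conditions*, Commun. Math. Phys. **99** (1985) 75–102
`[Balaban1985RegularSpaces]` ("B8"; journal page = PDF page + 74): (1.139)–(1.140) p. 100 («L^jη|A|, (L^jη)²|∇^η_{U₀}A|, (L^jη)³|D^{η*}_{U₀}D^η_{U₀}A| < α₂
on Ω_j»), (1.1) p. 76 (the covariant derivatives), p. 77 (the convention «bonds ∕ plaquettes on Ω_j»).  T. Bałaban, *Propagators for lattice gauge
theories in a background field*, Commun. Math. Phys. **99** (1985) 389–434 `[Balaban1985BackgroundPropagators]`, (3.4) p. 391.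

## WHY THIS FILE (cell `pub-ymgap`, HUMAN RULING D-0062 ∕ D-0149 ∕ D-0154; N05 = [B8]; width seat `pub-ymgap-dag-n05-w5` g3, CLAIM-2 of 2026-08-28T08:07Z)

Every P₇-currency certificate of the N05 lineage verifies the carrier's honest (1.140) predicate `zdGF3.C140` for its witness by hand, member by member
(`B8Prop7PrintedRZdGF3P2HalfSpaceAllL` §2 for the CONSTANT configuration).  The box-form certificate `B8Prop7PrintedRZdGF3BoxFormInterTower` needs it
for a pure gauge with a NON-LINEAR potential `ψ`; this file proves it ONCE for every potential and every member all of whose bonds touch `Ω₀`, from two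
displayed lattice-difference bounds — the reusable form.

## WHAT IS PROVED (kernel, 0 sorry; theorems only)

* §1 `sideTouches_coord_le`: a bond that is a side of a plaquette touching a set of sites with `τ`-coordinate `≤ h` has base `τ`-coordinate `≤ h`
  (print's p. 77 convention, bookkeeping for «which bonds touch `Ω_j`»).
* §2 `plaqCovDeriv_potential_eq_zero` (the linearised plaquette field of `A = −dψ∕η` at `U₀ = 1` is `0`: `d² = 0`) and ★ `c140_zdGF3_potential`:
  `Lʲ·|ψ(y+e_τ) − ψ(y)| < α₂` and `L^{2j}·|Δ_κΔ_τψ(y)| < α₂` on the bonds touching `Ω_j` (`j ≤ k`), `16α₂ ≤ 1` ⟹ `(zdGF3 ℂ L β len i).C140 α₂ U₀ P` for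
  `U₀ = 1`, `P = (U₀, e^{iηA})` (`mlogCfg_spec` gives `mlogCfg = A`).

## HONEST SCOPE

Bookkeeping of the typed hypothesis (1.140) on an explicit class of configurations; NO estimate of [Balaban1985RegularSpaces] is proved or asserted.
Count-neutral helper keyed `stmt-QuantumFields-26907` (K1⁸ `StabilityBRunRowsAtRecordR13SepCoPH`, route rev 27; successor of the aside K1⁷ 20542); N05 NOT discharged; no summit statement is proved by this seat — R4 closes the
conditional finite-`𝕋⁴` rung `BalabanLadder.UV` only; nothing continuum ∕ ℝ⁴ ∕ OS ∕ mass-gap ∕ Clay.  No `sorry`, no `def`, no `instance`, no `notation`.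
Unit `pub-ymgap-dag-n05-w5` (g3), 2026-08-28.

[cite: Balaban1985RegularSpaces, (1.139)–(1.140) p.100, (1.1) p.76, p.77; Balaban1985BackgroundPropagators, (3.4) p.391]
-/

noncomputable section

open NormedSpace Finset

namespace Literature.MathematicalPhysics.QuantumFieldTheory.Balaban1983to89.B8Eq140PureGaugePotential

open Complex (I)
open B7Prop1Explicit B7Prop1Local
open B8Ineq132 (covDerivFwd PlaqTouches)
open B8Eq140Level (SideTouches IsSide)
open B8Eq143PlaqExpansion (pdiv)
open B8Eq146AExpansion (plaqCovDeriv plaqCovDeriv_eq_covDerivFwd)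
open B8Eq184Proof (cfgExp)
open B8LeafModelZd (ZdIdx)
open B8LeafModelZd3 (zdGF3 mlogCfg mlogCfg_spec)

-- `Site` alone could resolve to the torus sites of `Setup.lean`; re-export the `ℤ^d` sites of `B7Prop1Explicit`.
export B7Prop1Explicit (Site)

/-! ## §1 Where a bond touching a box can sit -/

/-- If the bond `⟨y, y + e_τ⟩` is a side of a plaquette touching `S`, and every point of `S` has `τ`-coordinate `≤ h`, then `y_τ ≤ h`.
[cite: Balaban1985RegularSpaces, p.77 (convention before (1.5); bookkeeping)] -/
theorem sideTouches_coord_le {S : Set (Site 4)} {h : ℤ} {τ : Fin 4} (hS : ∀ c ∈ S, c τ ≤ h) {y : Site 4}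
    (hst : SideTouches S y τ) : y τ ≤ h := by
  obtain ⟨z, κ, ν, hκν, hP, hsd⟩ := hst
  have he : ∀ μ μ' : Fin 4, (0 : ℤ) ≤ e μ μ' := fun μ μ' => by rw [e_apply]; split_ifs <;> norm_num
  have hyz : y τ = z τ := by
    rcases hsd with ⟨rfl, rfl⟩ | ⟨rfl, rfl⟩ | ⟨rfl, rfl⟩ | ⟨rfl, rfl⟩
    · rfl
    · rw [Pi.add_apply, e_apply, if_neg (fun h => hκν h.symm), add_zero]
    · rw [Pi.add_apply, e_apply, if_neg (fun h => hκν h), add_zero]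
    · rfl
  rw [hyz]
  rcases hP with hc | hc | hc | hc
  · exact hS _ hc
  · have := hS _ hc; simp only [Pi.add_apply] at this; linarith [he κ τ]
  · have := hS _ hc; simp only [Pi.add_apply] at this; linarith [he ν τ]
  · have := hS _ hc; simp only [Pi.add_apply] at this; linarith [he κ τ, he ν τ]

/-! ## §2 (1.139)–(1.140) for a scalar PURE GAUGE `U₁ = e^{iηA}`, `A = −dψ∕η`, at `U₀ = 1`: the third member vanishes identically, the first two
are the first and second lattice differences of the potential -/

section C140

variable {L : ℕ}

/-- The Lie-algebra configuration of the scalar pure gauge: `A(y, y+e_τ) = (ψ(y) − ψ(y+e_τ))∕η` (so that `e^{iηA} = g·1·g⁻¹`, `g = e^{iψ}`,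
`B7GaugeFixingPureGauge.cfgExp_potential_eq_gaugeAct`).  Its norm is `|ψ(y+e_τ) − ψ(y)|∕η`. [cite: Balaban1985RegularSpaces, p.100 («U₁ = e^{iηA}»; bookkeeping)] -/
private theorem norm_potential {η : ℝ} (hη : 0 < η) (ψ : Site 4 → ℝ) (y : Site 4) (τ : Fin 4) :
    ‖((((ψ y - ψ (y + e τ)) / η : ℝ)) : ℂ)‖ = |ψ (y + e τ) - ψ y| * η⁻¹ := by
  rw [Complex.norm_real, Real.norm_eq_abs, abs_div, abs_of_pos hη, abs_sub_comm, div_eq_mul_inv]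

/-- The forward covariant derivative (1.1) at `U₀ = 1` of the potential configuration is the second lattice difference of `ψ` over `η²`.
[cite: Balaban1985RegularSpaces, (1.1) p.76 (bookkeeping at `U₀ = 1`)] -/
private theorem norm_covDerivFwd_potential {η : ℝ} (hη : 0 < η) (ψ : Site 4 → ℝ) (y : Site 4) (τ κ : Fin 4) :
    ‖covDerivFwd η (1 : Site 4 → Fin 4 → ℂˣ) κ (fun z => ((((ψ z - ψ (z + e τ)) / η : ℝ)) : ℂ)) y‖
      = |(ψ (y + e κ + e τ) - ψ (y + e κ)) - (ψ (y + e τ) - ψ y)| * (η⁻¹) ^ 2 := by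
  simp only [covDerivFwd, B7Eq78Linearization.conjR_apply, Pi.one_apply, Units.val_one, inv_one, one_mul, mul_one]
  rw [norm_smul, Real.norm_eq_abs, abs_inv, abs_of_pos hη, ← Complex.ofReal_sub, Complex.norm_real, Real.norm_eq_abs,
    ← sub_div, abs_div, abs_of_pos hη]
  rw [show ψ (y + e κ) - ψ (y + e κ + e τ) - (ψ y - ψ (y + e τ)) = -((ψ (y + e κ + e τ) - ψ (y + e κ)) - (ψ (y + e τ) - ψ y)) by ring,
    abs_neg]
  ring

/-- **The third member of (1.140) VANISHES on a pure gauge**: the linearised plaquette field `(D^η_{U₀}A)(p) = D_μA_ν − D_νA_μ` of `A = −dψ∕η` at `U₀ = 1`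
is the lattice curl of a lattice gradient, identically `0` (`d² = 0`). [cite: Balaban1985RegularSpaces, (1.140) p.100; Balaban1985BackgroundPropagators, (3.4) p.391] -/
theorem plaqCovDeriv_potential_eq_zero (η : ℝ) (ψ : Site 4 → ℝ) :
    plaqCovDeriv η (1 : Site 4 → Fin 4 → ℂˣ) (fun z τ => ((((ψ z - ψ (z + e τ)) / η : ℝ)) : ℂ)) = fun _ _ _ => 0 := by
  funext μ ν x
  rw [plaqCovDeriv_eq_covDerivFwd]
  simp only [covDerivFwd, B7Eq78Linearization.conjR_apply, Pi.one_apply, Units.val_one, inv_one, one_mul, mul_one, ← smul_sub]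
  rw [add_right_comm x (e ν) (e μ)]
  have : ((((ψ (x + e μ) - ψ (x + e μ + e ν)) / η : ℝ)) : ℂ) - ((((ψ x - ψ (x + e ν)) / η : ℝ)) : ℂ)
      - (((((ψ (x + e ν) - ψ (x + e μ + e ν)) / η : ℝ)) : ℂ) - ((((ψ x - ψ (x + e μ)) / η : ℝ)) : ℂ)) = 0 := by
    push_cast; ring
  rw [this, smul_zero]

/-- ★ **(1.140) — ALL THREE MEMBERS — FOR A SCALAR PURE GAUGE FROM TWO LATTICE-DIFFERENCE BOUNDS ON THE POTENTIAL** (NODE 00's carrier `zdGF3`, `d = 4`,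
`U₀ = 1`, `U₁ = e^{iηA}`, `A = −dψ∕η`, any member `i` all of whose bonds touch `Ω₀`): if on every bond `⟨y, y+e_τ⟩` touching `Ω_j` (`j ≤ k`)
`Lʲ·|ψ(y+e_τ) − ψ(y)| < α₂` and `L^{2j}·|Δ_κΔ_τψ(y)| < α₂` for every `κ`, and `16α₂ ≤ 1`, then the carrier's honest (1.140) predicate `C140 α₂` holds:
the canonical masked logarithm IS `A` (`mlogCfg_spec`), the first member is `Lʲ|Δψ|`, the second `L^{2j}|ΔΔψ|`, the third is `0`
(`plaqCovDeriv_potential_eq_zero`). [cite: Balaban1985RegularSpaces, (1.139)–(1.140) p.100, (1.1) p.76] -/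
theorem c140_zdGF3_potential (hL : 1 ≤ L) (β : ℝ) (len : Site 4 → ℝ) (i : ZdIdx 4 L) (hall : ∀ (y : Site 4) (τ : Fin 4), SideTouches (i.Ω 0) y τ)
    (ψ : Site 4 → ℝ) {α₂ : ℝ} (hα : 0 < α₂) (hα16 : 16 * α₂ ≤ 1)
    (h1 : ∀ j, j ≤ i.k → ∀ (y : Site 4) (τ : Fin 4), SideTouches (i.Ω j) y τ → (L : ℝ) ^ j * |ψ (y + e τ) - ψ y| < α₂)
    (h2 : ∀ j, j ≤ i.k → ∀ (y : Site 4) (τ κ : Fin 4), SideTouches (i.Ω j) y τ →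
      ((L : ℝ) ^ j) ^ 2 * |(ψ (y + e κ + e τ) - ψ (y + e κ)) - (ψ (y + e τ) - ψ y)| < α₂)
    (U₀ : (zdGF3 ℂ L β len i).Cfg) (hU₀ : U₀.1 = 1)
    (P : (zdGF3 ℂ L β len i).Pert) (hP : P.2.1 = cfgExp i.η (fun z τ => ((((ψ z - ψ (z + e τ)) / i.η : ℝ)) : ℂ))) :
    (zdGF3 ℂ L β len i).C140 α₂ U₀ P := by
  set A : Site 4 → Fin 4 → ℂ := fun z τ => ((((ψ z - ψ (z + e τ)) / i.η : ℝ)) : ℂ) with hAdef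
  have hη := i.hη
  have hAh : ∀ (y : Site 4) (κ : Fin 4), IsSelfAdjoint (A y κ) := fun _ _ => by
    rw [hAdef]; exact Complex.conj_ofReal _
  -- the hypothesis of `mlogCfg_spec`: `‖A‖ ≤ α₂ (Lʲη)⁻¹` on the bonds touching `Ω_j`
  have hWA : ∀ j, j ≤ i.k → ∀ (y : Site 4) (τ : Fin 4), SideTouches (i.Ω j) y τ →
      P.2.1 y τ = cfgExp i.η A y τ ∧ ‖A y τ‖ ≤ α₂ * ((L : ℝ) ^ j * i.η)⁻¹ := by
    intro j hj y τ hst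
    refine ⟨by rw [hP], ?_⟩
    rw [hAdef, norm_potential hη, mul_inv]
    have hLj : (0 : ℝ) < (L : ℝ) ^ j := by positivity
    have := h1 j hj y τ hst
    -- `|Δψ| ≤ α₂ / Lʲ`
    have hle : |ψ (y + e τ) - ψ y| ≤ α₂ * ((L : ℝ) ^ j)⁻¹ := by
      rw [← div_eq_mul_inv, le_div_iff₀ hLj, mul_comm]; exact this.le
    calc |ψ (y + e τ) - ψ y| * i.η⁻¹ ≤ α₂ * ((L : ℝ) ^ j)⁻¹ * i.η⁻¹ :=
          mul_le_mul_of_nonneg_right hle (inv_nonneg.mpr hη.le)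
      _ = α₂ * (((L : ℝ) ^ j)⁻¹ * i.η⁻¹) := by ring
  obtain ⟨hmsa, hmeq, -⟩ := mlogCfg_spec (W := P.2.1) hη hL i.k U₀.1 P.2.2 hα.le hα16 i.Ω hWA
  have hmA : mlogCfg i.k i.η i.Ω P.2.1 = A := by
    funext y τ
    exact (hmeq 0 (Nat.zero_le _) y τ (hall y τ)).1
  intro j hj y τ hst
  rw [hmA, hU₀]
  have hLj : (0 : ℝ) < (L : ℝ) ^ j := by positivity
  refine ⟨(hWA j hj y τ hst).1, hAh y τ, ?_, fun κ => ?_, ?_⟩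
  · -- first member: `Lʲη·‖A‖ = Lʲ|Δψ|`
    rw [hAdef, norm_potential hη]
    calc (L : ℝ) ^ j * i.η * (|ψ (y + e τ) - ψ y| * i.η⁻¹) = (L : ℝ) ^ j * |ψ (y + e τ) - ψ y| := by
          field_simp
      _ < α₂ := h1 j hj y τ hst
  · -- second member: `(Lʲη)²·‖D_κ A_τ‖ = L^{2j}|Δ_κΔ_τψ|`
    rw [hAdef, norm_covDerivFwd_potential hη]
    calc ((L : ℝ) ^ j * i.η) ^ 2 * (|(ψ (y + e κ + e τ) - ψ (y + e κ)) - (ψ (y + e τ) - ψ y)| * (i.η⁻¹) ^ 2)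
        = ((L : ℝ) ^ j) ^ 2 * |(ψ (y + e κ + e τ) - ψ (y + e κ)) - (ψ (y + e τ) - ψ y)| := by
          field_simp
      _ < α₂ := h2 j hj y τ κ hst
  · -- third member: identically zero
    rw [hAdef, plaqCovDeriv_potential_eq_zero]
    have h0 : pdiv i.η (1 : Site 4 → Fin 4 → ℂˣ) (fun (_ _ : Fin 4) (_ : Site 4) => (0 : ℂ)) τ y = 0 := by
      simp [pdiv, B8Ineq132.covDeriv, B7Eq78Linearization.conjR_apply]
    rw [h0, norm_zero, mul_zero]
    exact hα

end C140

end Literature.MathematicalPhysics.QuantumFieldTheory.Balaban1983to89.B8Eq140PureGaugePotential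

end
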